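import Literature.AnabelianGeometry.SemiGraphs.TemperoidsGCConnectedProofs
import Literature.AnabelianGeometry.SemiGraphs.TemperoidsHomEqResProofs

/-!
# [SemiAnbd] Proposition 3.2: `GCConnectedTemperoids` DISCHARGED

Mochizuki, *Semi-graphs of anabelioids*, Publ. RIMS **42** (2006), §3, Proposition 3.2 p. 35
[cite: MochizukiSemiAnbd2006, Prop 3.2 p.35].  The two-line composition of the reduction
`GCConnectedTemperoids_of` (full faithfulness of `φ ↦ B^temp(φ)`, `TemperoidsGCConnectedProofs`)
with the surjectivity half `TemperoidHomEqRes_holds` (`TemperoidsHomEqResProofs`).  Proof-only file.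
-/

namespace Literature.AnabelianGeometry.SemiGraphs

universe u

/-- NAMED FACT `GCConnectedTemperoids` ([SemiAnbd] Proposition 3.2, "Grothendieck conjecture for
connected temperoids") — DISCHARGED: for Galois-countable tempered groups `Π₁, Π₂`, the category of
morphisms of temperoids `B^temp(Π₁) → B^temp(Π₂)` is equivalent to the category of continuous
homomorphisms `Π₁ → Π₂` with conjugating elements as morphisms. [cite: MochizukiSemiAnbd2006, Prop 3.2 p.35] -/
theorem GCConnectedTemperoids_holds : ∀ (G₁ : Type u) [Group G₁] [TopologicalSpace G₁]
    (G₂ : Type u) [Group G₂] [TopologicalSpace G₂], GCConnectedTemperoids G₁ G₂ :=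
  fun G₁ _ _ G₂ _ _ => GCConnectedTemperoids_of G₁ G₂ (TemperoidHomEqRes_holds G₁ G₂)

end Literature.AnabelianGeometry.SemiGraphs
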